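import Summits.AtomisticToContinuum.Crystallization.Theorems.PalmUnimodularRigidityShellsToBarlowChartTransportSteps1
import Summits.AtomisticToContinuum.Crystallization.Theorems.PalmUnimodularRigidityShellsToBarlowChartTransportSteps2
import Summits.AtomisticToContinuum.Crystallization.Theorems.PalmUnimodularRigidityShellsToBarlowChartTransportSteps3
import Summits.AtomisticToContinuum.Crystallization.Theorems.PalmUnimodularRigidityShellsToBarlowChartTransportSteps5
import Summits.AtomisticToContinuum.Crystallization.Theorems.PalmUnimodularRigidityShellsToBarlowChartTransportSteps7
import Summits.AtomisticToContinuum.Crystallization.Theorems.PalmUnimodularRigidityShellsToBarlowChartTransportAttach1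
import Summits.AtomisticToContinuum.Crystallization.Theorems.PalmUnimodularRigidityShellsToBarlowChartTransportComm1
import Summits.AtomisticToContinuum.Crystallization.Theorems.PalmUnimodularRigidityShellsToBarlowChartTransportComm2

/-!
# Line `develop-the-model-growth-descent` (crux `ShellsToBarlowChart`, stmt-AtomisticToContinuum-9227): commutation of `V` with `I` and `J` (part 3/3)

Helper lemmas for `stub_transportSystem` (the geometric half of the line): frames `⟨x, t₁, t₂, U⟩`
read in the integer charts `IsZChart` of a good-shell configuration, their transports and the
coherence of the resulting development `frameAt`.  The only metric inputs are the chart transfer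
lemma and `bond_nb_iff`; everything else is label combinatorics in `ℤ³` (pattern facts
`TransportPatterns*`).  All `[folklore]` (HalesDSP2012 §1.3 for the two kissing patterns).
-/

noncomputable section

namespace Summit.AtomisticToContinuum.Crystallization.Theorems.PalmUnimodularRigidityShellsToBarlowChart

open Literature.Geometry.DiscreteGeometry Literature.MathematicalPhysics.StatisticalMechanics
open Summit.AtomisticToContinuum.Crystallization.Theorems.ShellsToBarlowChartNegative

variable {S : Set (EuclideanSpace ℝ (Fin 3))} {ac : (EuclideanSpace ℝ (Fin 3)) → ℝ} {Pc : (EuclideanSpace ℝ (Fin 3)) → Finset (Fin 3 → ℤ)}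
  {Ac : (EuclideanSpace ℝ (Fin 3)) → ((EuclideanSpace ℝ (Fin 3)) →ₗᵢ[ℝ] (EuclideanSpace ℝ (Fin 3)))} {nb : (EuclideanSpace ℝ (Fin 3)) → (Fin 3 → ℤ) → (EuclideanSpace ℝ (Fin 3))}

/-- **`V ∘ I = I ∘ V` (layer `k → k+1` coherence).**  For a valid frame `g` whose layer-`k`
neighbourhood (the eight frames `I^{±1} g, J^{±1} g, I² g, J I g, I⁻¹ I g, J⁻¹ I g`) is valid and
which commutes with the in-layer steps (`I (J g) = J (I g)`), the frame transported first along
`t₁` and then up equals the frame transported first up and then along its own `t₁`. [folklore] -/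
theorem Vstep_Istep_comm (hch : ∀ z ∈ S, IsZChart S z (ac z) (Pc z) (Ac z) (nb z)) {x : (EuclideanSpace ℝ (Fin 3))} (hx : x ∈ S) {t₁ t₂ : Fin 3 → ℤ} {U : Finset (Fin 3 → ℤ)} (hU : IsFrame (Pc x) t₁ t₂ U) (hI : IsFrame (Pc (nb x t₁)) (Istep Pc nb ⟨x, t₁, t₂, U⟩).t₁ (Istep Pc nb ⟨x, t₁, t₂, U⟩).t₂ (Istep Pc nb ⟨x, t₁, t₂, U⟩).U) (hJ : IsFrame (Pc (nb x t₂)) (Jstep Pc nb ⟨x, t₁, t₂, U⟩).t₁ (Jstep Pc nb ⟨x, t₁, t₂, U⟩).t₂ (Jstep Pc nb ⟨x, t₁, t₂, U⟩).U) (hIi : IsFrame (Pc (nb x (-t₁))) (IinvStep Pc nb ⟨x, t₁, t₂, U⟩).t₁ (IinvStep Pc nb ⟨x, t₁, t₂, U⟩).t₂ (IinvStep Pc nb ⟨x, t₁, t₂, U⟩).U) (hJi : IsFrame (Pc (nb x (-t₂))) (JinvStep Pc nb ⟨x, t₁, t₂, U⟩).t₁ (JinvStep Pc nb ⟨x, t₁,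 t₂, U⟩).t₂ (JinvStep Pc nb ⟨x, t₁, t₂, U⟩).U) (hII : IsFrame (Pc (nb (nb x t₁) (Istep Pc nb ⟨x, t₁, t₂, U⟩).t₁)) (Istep Pc nb (Istep Pc nb ⟨x, t₁, t₂, U⟩)).t₁ (Istep Pc nb (Istep Pc nb ⟨x, t₁, t₂, U⟩)).t₂ (Istep Pc nb (Istep Pc nb ⟨x, t₁, t₂, U⟩)).U) (hJI : IsFrame (Pc (nb (nb x t₁) (Istep Pc nb ⟨x, t₁, t₂, U⟩).t₂)) (Jstep Pc nb (Istep Pc nb ⟨x, t₁, t₂, U⟩)).t₁ (Jstep Pc nb (Istep Pc nb ⟨x, t₁, t₂, U⟩)).t₂ (Jstep Pc nb (Istep Pc nb ⟨x, t₁, t₂, U⟩)).U) (hIiI : IsFrame (Pc (nb (nb x t₁) (-(Istep Pc nb ⟨x, t₁, t₂, U⟩).t₁))) (IinvStep Pc nb (Istep Pc nb ⟨x, t₁, t₂, U⟩)).t₁ (IinvStep Pc nb (Istep Pc nb ⟨x, t₁, t₂, U⟩)).t₂ (IinvStep Pc nb (Istep Pc nb ⟨x, t₁, t₂, U⟩)).U)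 (hJiI : IsFrame (Pc (nb (nb x t₁) (-(Istep Pc nb ⟨x, t₁, t₂, U⟩).t₂))) (JinvStep Pc nb (Istep Pc nb ⟨x, t₁, t₂, U⟩)).t₁ (JinvStep Pc nb (Istep Pc nb ⟨x, t₁, t₂, U⟩)).t₂ (JinvStep Pc nb (Istep Pc nb ⟨x, t₁, t₂, U⟩)).U) (hcomm : Istep Pc nb (Jstep Pc nb ⟨x, t₁, t₂, U⟩) = Jstep Pc nb (Istep Pc nb ⟨x, t₁, t₂, U⟩)) : Vstep Pc nb (Istep Pc nb ⟨x, t₁, t₂, U⟩) = Istep Pc nb (Vstep Pc nb ⟨x, t₁, t₂, U⟩) := by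
  have hregI := hregI_of_valid (Pc := Pc) (nb := nb) hI
  obtain ⟨hyS, hbxy, hwP, hwx, -, -, -, -, -, -, -, hframe, hparI, -⟩ := Istep_spec hch hx hU hregI
  obtain ⟨hcU, huS, hbu, hξP, hξx, hframeV, -, hbr⟩ := Vstep_spec hch hx hU hI hJ hIi hJi
  obtain ⟨hpt, hbuu', -⟩ := Vstep_Istep_pt hch hx hU hI hJ hIi hJi
  obtain ⟨hα, -⟩ := Vstep_Istep_back hch hx hU hI hJ hIi hJi hII hJI hIiI hJiI
  obtain ⟨hβ, -⟩ := Vstep_Istep_side hch hx hU hI hJ hIi hJi hII hJI hIiI hJiI hcomm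
  obtain ⟨hptJ, -, -⟩ := Vstep_Jstep_pt hch hx hU hI hJ hIi hJi
  have hPx := pattern_cases hch hx
  have hPy := pattern_cases hch hyS
  have hPu := pattern_cases hch huS
  obtain ⟨h12, hhex, hUP, -, -⟩ := id hU
  have ht₁ : t₁ ∈ Pc x := hhex (mem_hexLabels_iff.2 (Or.inl rfl))
  have ht₂ : t₂ ∈ Pc x := hhex (mem_hexLabels_iff.2 (Or.inr (Or.inl rfl)))
  -- canonical names at `x`: `c, u, t₁', t₂', UV`
  set c := apexOf t₁ t₂ U with hc_def
  have hcP : c ∈ Pc x := hUP hcU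
  have hVpt : (Vstep Pc nb ⟨x, t₁, t₂, U⟩).pt = nb x c := rfl
  rw [hVpt] at *
  set u := nb x c with hu_def
  set t₁' := (Vstep Pc nb ⟨x, t₁, t₂, U⟩).t₁ with ht₁'_def
  set t₂' := (Vstep Pc nb ⟨x, t₁, t₂, U⟩).t₂ with ht₂'_def
  set UV := (Vstep Pc nb ⟨x, t₁, t₂, U⟩).U with hUV_def
  have hVeq : Vstep Pc nb ⟨x, t₁, t₂, U⟩ = ⟨u, t₁', t₂', UV⟩ := rfl
  have ht₁'P : t₁' ∈ Pc u := hframeV.2.1 (mem_hexLabels_iff.2 (Or.inl rfl))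
  have ht₂'P : t₂' ∈ Pc u := hframeV.2.1 (mem_hexLabels_iff.2 (Or.inr (Or.inl rfl)))
  have hUVP : UV ⊆ Pc u := hframeV.2.2.1
  -- the frame `I g = ⟨y, a', b', U'⟩`
  set a' := (Istep Pc nb ⟨x, t₁, t₂, U⟩).t₁ with ha'
  set b' := (Istep Pc nb ⟨x, t₁, t₂, U⟩).t₂ with hb'
  set U' := (Istep Pc nb ⟨x, t₁, t₂, U⟩).U with hU'
  have hIeq : Istep Pc nb ⟨x, t₁, t₂, U⟩ = ⟨nb x t₁, a', b', U'⟩ := rfl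
  rw [hIeq] at hII hJI hIiI hJiI hpt hbuu' hα hβ ⊢
  obtain ⟨hc'U, hu'S, hbu', hξ'P, hξ'x, hframeV', -, hbr'⟩ :=
    Vstep_spec hch hyS hframe hII hJI hIiI hJiI
  obtain ⟨h12', hhex', hUP', -, -⟩ := id hframe
  set c' := apexOf a' b' U' with hc'_def
  have hc'P : c' ∈ Pc (nb x t₁) := hUP' hc'U
  have hV'pt : (Vstep Pc nb ⟨nb x t₁, a', b', U'⟩).pt = nb (nb x t₁) c' := rfl
  rw [hV'pt] at *
  set u' := nb (nb x t₁) c' with hu'_def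
  set t₁'' := (Vstep Pc nb ⟨nb x t₁, a', b', U'⟩).t₁ with ht₁''_def
  set t₂'' := (Vstep Pc nb ⟨nb x t₁, a', b', U'⟩).t₂ with ht₂''_def
  set U₁ := (Vstep Pc nb ⟨nb x t₁, a', b', U'⟩).U with hU₁_def
  have hV'eq : Vstep Pc nb ⟨nb x t₁, a', b', U'⟩ = ⟨u', t₁'', t₂'', U₁⟩ := rfl
  have hU₁eq : U₁ = capOpp (Pc u') t₁'' t₂'' (zlab Pc nb u' (nb x t₁)) := rfl
  have hPu' := pattern_cases hch hu'S
  obtain ⟨h12'', hhex'', -, hoff'', -⟩ := id hframeV'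
  have ht₁''P : t₁'' ∈ Pc u' := hhex'' (mem_hexLabels_iff.2 (Or.inl rfl))
  have ht12''P : t₁'' - t₂'' ∈ Pc u' :=
    hhex'' (mem_hexLabels_iff.2 (Or.inr (Or.inr (Or.inr (Or.inr (Or.inr rfl))))))
  -- the three identifications (a), (b), (c)
  have hu' : nb u t₁' = u' := hpt.symm
  have hw' : zlab Pc nb u' u = -t₁'' := hα
  rw [hVeq] at hptJ
  have huJ : nb u t₂' = (Vstep Pc nb (Jstep Pc nb ⟨x, t₁, t₂, U⟩)).pt := hptJ.symm
  have hv' : zlab Pc nb u' (nb u t₂') = t₂'' - t₁'' := by rw [huJ]; exact hβ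
  -- the I-step of `V g` (layer `k+1`): regime from (b), (c)
  have hreg3 : Pc (nb u t₁') = fcc3Int ∨ Pc u = hcpInt ∨
      (-zlab Pc nb (nb u t₁') u ∈ Pc (nb u t₁') ∧ -zlab Pc nb (nb u t₁') (nb u t₂') ∈ Pc (nb u t₁')) := by
    refine Or.inr (Or.inr ⟨?_, ?_⟩)
    · rw [hu', hw', neg_neg]; exact ht₁''P
    · rw [hu', hv', neg_sub]; exact ht12''P
  obtain ⟨-, -, -, -, -, -, -, -, -, -, -, hframe₂, -, c₁, hc₁U, -, -, hbur, hrU, hUeq₂, -⟩ :=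
    Istep_spec hch huS hframeV hreg3
  -- components of `I (V g)`
  have ept : (Istep Pc nb ⟨u, t₁', t₂', UV⟩).pt = u' := hu'
  have e₁ : (Istep Pc nb ⟨u, t₁', t₂', UV⟩).t₁ = t₁'' := by
    show -zlab Pc nb (nb u t₁') u = t₁''
    rw [hu', hw', neg_neg]
  have e₂ : (Istep Pc nb ⟨u, t₁', t₂', UV⟩).t₂ = t₂'' := by
    show zlab Pc nb (nb u t₁') (nb u t₂') - zlab Pc nb (nb u t₁') u = t₂''
    rw [hu', hv', hw']; abel
  rw [hu'] at hframe₂ hbur hrU hUeq₂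
  rw [e₁, e₂] at hframe₂ hUeq₂
  -- the transported upper reference `r` lies in `U₁`
  have hc₁P : c₁ ∈ Pc u := hUVP hc₁U
  have hrS : nb u c₁ ∈ S := (nb_mem hch huS hc₁P).1
  have hr : zlab Pc nb u' (nb u c₁) ∈ Pc u' ∧ nb u' (zlab Pc nb u' (nb u c₁)) = nb u c₁ :=
    zlab_spec hch hu'S hrS hbur
  have hroff : zlab Pc nb u' (nb u c₁) ∉ hexLabels t₁'' t₂'' := hframe₂.2.2.2.1 _ hrU
  have hrU₁ : zlab Pc nb u' (nb u c₁) ∈ U₁ := by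
    rcases hbr with ⟨hpar, hL, hnI, -, -⟩ | ⟨hpar, hL, hnI, -, -⟩
    · -- EVEN: reference label `ξ'V` of `y = nb u (ξ + t₁')`
      have hηL : zlab Pc nb u x + t₁' ∈ lowerCap (Pc u) t₁' t₂' UV := by rw [hL]; simp
      have hηP : zlab Pc nb u x + t₁' ∈ Pc u := (mem_lowerCap_iff.1 hηL).1
      have hcross := cross_dist hPu hframeV hc₁U hηL
      have hbu'y : 0 < dist u' (nb u (zlab Pc nb u x + t₁')) ∧
          dist u' (nb u (zlab Pc nb u x + t₁')) ≤ 28 / 25 := by rw [hnI]; exact bond_symm hbu'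
      have htr := transfer_nb_nb hch huS hu'S hbuu' hc₁P hηP hbur hbu'y
      rw [hnI] at htr
      rw [hU₁eq]
      simp only [capOpp, Finset.mem_filter]
      refine ⟨hr.1, hroff, ?_, ?_⟩
      · intro heq
        apply hcross.1
        rw [← htr, heq, sub_self, sqNormInt_zero]
      · rw [htr]; exact hcross.2
    · -- ODD: reference label of `x = nb u ξ`, then switch the reference inside the lower cap
      have hξL : zlab Pc nb u x ∈ lowerCap (Pc u) t₁' t₂' UV := by rw [hL]; simp
      have hcross := cross_dist hPu hframeV hc₁U hξL
      obtain ⟨hattI, -⟩ := attach_I_odd hch hx hU hpar hregI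
      rw [hIeq] at hattI
      obtain ⟨-, -, -, hc1, -, -⟩ := odd_form_of_parity hPx hU hpar
      have hu'x : nb x (c + t₁) = u' := hattI.symm
      have hbxu' : 0 < dist x u' ∧ dist x u' ≤ 28 / 25 := by
        rw [← hu'x]; exact (nb_mem hch hx hc1).2
      have hbu'x : 0 < dist u' (nb u (zlab Pc nb u x)) ∧ dist u' (nb u (zlab Pc nb u x)) ≤ 28 / 25 := by
        rw [hξx]; exact bond_symm hbxu'
      have htr := transfer_nb_nb hch huS hu'S hbuu' hc₁P hξP hbur hbu'x
      rw [hξx] at htr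
      -- the lower cap of `V (I g)` contains the label of `x`
      have hpar' : frameParity a' b' U' = -1 := hparI.trans hpar
      rcases hbr' with ⟨hpar'', -, -, -, -⟩ | ⟨-, hL', hnI', -, -⟩
      · rw [hpar'] at hpar''; norm_num at hpar''
      have hyx : nb (nb x t₁) (-a') = x := by
        show nb (nb x t₁) (-(-zlab Pc nb (nb x t₁) x)) = x
        rw [neg_neg]; exact hwx
      rw [hyx] at hnI'
      have hxL : zlab Pc nb u' (nb x t₁) - t₁'' ∈ lowerCap (Pc u') t₁'' t₂'' U₁ := by rw [hL']; simp
      have hxlab : zlab Pc nb u' x = zlab Pc nb u' (nb x t₁) - t₁'' := by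
        have h := zlab_nb hch hu'S (mem_lowerCap_iff.1 hxL).1
        rwa [hnI'] at h
      have hcap : capOpp (Pc u') t₁'' t₂'' (zlab Pc nb u' x) = U₁ := by
        rw [hxlab]; exact capOpp_lower hPu' hframeV' hxL
      rw [← hcap]
      simp only [capOpp, Finset.mem_filter]
      refine ⟨hr.1, hroff, ?_, ?_⟩
      · intro heq
        apply hcross.1
        rw [← htr, heq, sub_self, sqNormInt_zero]
      · rw [htr]; exact hcross.2
  have hU₂ : (Istep Pc nb ⟨u, t₁', t₂', UV⟩).U = U₁ := by
    rw [hUeq₂]; exact capWithAny_of_mem_cap hch hu'S hframeV' hrU₁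
  -- assemble
  rw [hVeq, hV'eq]
  exact (ZFrame.ext' ept e₁ e₂ hU₂).symm

/-- `I ∘ swap = swap ∘ J` on frame literals. [folklore] -/
theorem Istep_swap (p : (EuclideanSpace ℝ (Fin 3))) (a b : Fin 3 → ℤ) (W : Finset (Fin 3 → ℤ)) :
    Istep Pc nb ⟨p, b, a, W⟩ = ⟨(Jstep Pc nb ⟨p, a, b, W⟩).pt, (Jstep Pc nb ⟨p, a, b, W⟩).t₂,
      (Jstep Pc nb ⟨p, a, b, W⟩).t₁, (Jstep Pc nb ⟨p, a, b, W⟩).U⟩ := by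
  rw [Jstep_swap]

/-- `I⁻¹ ∘ swap = swap ∘ J⁻¹` on frame literals. [folklore] -/
theorem IinvStep_swap (p : (EuclideanSpace ℝ (Fin 3))) (a b : Fin 3 → ℤ) (W : Finset (Fin 3 → ℤ)) :
    IinvStep Pc nb ⟨p, b, a, W⟩ = ⟨(JinvStep Pc nb ⟨p, a, b, W⟩).pt, (JinvStep Pc nb ⟨p, a, b, W⟩).t₂,
      (JinvStep Pc nb ⟨p, a, b, W⟩).t₁, (JinvStep Pc nb ⟨p, a, b, W⟩).U⟩ := by
  rw [JinvStep_swap]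

/-- Structure eta for frames. [folklore] -/
theorem ZFrame.eta (f : ZFrame) : (⟨f.pt, f.t₁, f.t₂, f.U⟩ : ZFrame) = f := by
  cases f; rfl

/-- `V ∘ swap = swap ∘ V`, frame form. [folklore] -/
theorem Vstep_swap' {f : ZFrame} (hP : Pc f.pt = fcc3Int ∨ Pc f.pt = hcpInt)
    (hU : IsFrame (Pc f.pt) f.t₁ f.t₂ f.U) :
    Vstep Pc nb ⟨f.pt, f.t₂, f.t₁, f.U⟩ = ⟨(Vstep Pc nb f).pt, (Vstep Pc nb f).t₂,
      (Vstep Pc nb f).t₁, (Vstep Pc nb f).U⟩ := by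
  cases f; exact Vstep_swap hP hU

/-- `I ∘ swap = swap ∘ J`, frame form. [folklore] -/
theorem Istep_swap' (f : ZFrame) :
    Istep Pc nb ⟨f.pt, f.t₂, f.t₁, f.U⟩ = ⟨(Jstep Pc nb f).pt, (Jstep Pc nb f).t₂,
      (Jstep Pc nb f).t₁, (Jstep Pc nb f).U⟩ := by
  cases f; exact Istep_swap _ _ _ _

/-- `J ∘ swap = swap ∘ I`, frame form. [folklore] -/
theorem Jstep_swap' (f : ZFrame) :
    Jstep Pc nb ⟨f.pt, f.t₂, f.t₁, f.U⟩ = ⟨(Istep Pc nb f).pt, (Istep Pc nb f).t₂,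
      (Istep Pc nb f).t₁, (Istep Pc nb f).U⟩ := by
  cases f; exact Jstep_swap _ _ _ _

/-- `I⁻¹ ∘ swap = swap ∘ J⁻¹`, frame form. [folklore] -/
theorem IinvStep_swap' (f : ZFrame) :
    IinvStep Pc nb ⟨f.pt, f.t₂, f.t₁, f.U⟩ = ⟨(JinvStep Pc nb f).pt, (JinvStep Pc nb f).t₂,
      (JinvStep Pc nb f).t₁, (JinvStep Pc nb f).U⟩ := by
  cases f; exact IinvStep_swap _ _ _ _

/-- `J⁻¹ ∘ swap = swap ∘ I⁻¹`, frame form. [folklore] -/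
theorem JinvStep_swap' (f : ZFrame) :
    JinvStep Pc nb ⟨f.pt, f.t₂, f.t₁, f.U⟩ = ⟨(IinvStep Pc nb f).pt, (IinvStep Pc nb f).t₂,
      (IinvStep Pc nb f).t₁, (IinvStep Pc nb f).U⟩ := by
  cases f; exact JinvStep_swap _ _ _ _

/-- **`V ∘ J = J ∘ V` (layer `k → k+1` coherence along `t₂`)**, from `Vstep_Istep_comm` by the
swap symmetry.  Hypotheses: the layer-`k` neighbourhood of `g` along the J-line is valid and the
in-layer commutation holds at `g`. [folklore] -/
theorem Vstep_Jstep_comm (hch : ∀ z ∈ S, IsZChart S z (ac z) (Pc z) (Ac z) (nb z)) {x : (EuclideanSpace ℝ (Fin 3))}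
    (hx : x ∈ S) {t₁ t₂ : Fin 3 → ℤ} {U : Finset (Fin 3 → ℤ)} (hU : IsFrame (Pc x) t₁ t₂ U)
    (hI : IsFrame (Pc (nb x t₁)) (Istep Pc nb ⟨x, t₁, t₂, U⟩).t₁ (Istep Pc nb ⟨x, t₁, t₂, U⟩).t₂
      (Istep Pc nb ⟨x, t₁, t₂, U⟩).U)
    (hJ : IsFrame (Pc (nb x t₂)) (Jstep Pc nb ⟨x, t₁, t₂, U⟩).t₁ (Jstep Pc nb ⟨x, t₁, t₂, U⟩).t₂
      (Jstep Pc nb ⟨x, t₁, t₂, U⟩).U)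
    (hIi : IsFrame (Pc (nb x (-t₁))) (IinvStep Pc nb ⟨x, t₁, t₂, U⟩).t₁
      (IinvStep Pc nb ⟨x, t₁, t₂, U⟩).t₂ (IinvStep Pc nb ⟨x, t₁, t₂, U⟩).U)
    (hJi : IsFrame (Pc (nb x (-t₂))) (JinvStep Pc nb ⟨x, t₁, t₂, U⟩).t₁
      (JinvStep Pc nb ⟨x, t₁, t₂, U⟩).t₂ (JinvStep Pc nb ⟨x, t₁, t₂, U⟩).U)
    (hJJ : IsFrame (Pc (nb (nb x t₂) (Jstep Pc nb ⟨x, t₁, t₂, U⟩).t₂))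
      (Jstep Pc nb (Jstep Pc nb ⟨x, t₁, t₂, U⟩)).t₁ (Jstep Pc nb (Jstep Pc nb ⟨x, t₁, t₂, U⟩)).t₂
      (Jstep Pc nb (Jstep Pc nb ⟨x, t₁, t₂, U⟩)).U)
    (hIJ : IsFrame (Pc (nb (nb x t₂) (Jstep Pc nb ⟨x, t₁, t₂, U⟩).t₁))
      (Istep Pc nb (Jstep Pc nb ⟨x, t₁, t₂, U⟩)).t₁ (Istep Pc nb (Jstep Pc nb ⟨x, t₁, t₂, U⟩)).t₂
      (Istep Pc nb (Jstep Pc nb ⟨x, t₁, t₂, U⟩)).U)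
    (hJiJ : IsFrame (Pc (nb (nb x t₂) (-(Jstep Pc nb ⟨x, t₁, t₂, U⟩).t₂)))
      (JinvStep Pc nb (Jstep Pc nb ⟨x, t₁, t₂, U⟩)).t₁ (JinvStep Pc nb (Jstep Pc nb ⟨x, t₁, t₂, U⟩)).t₂
      (JinvStep Pc nb (Jstep Pc nb ⟨x, t₁, t₂, U⟩)).U)
    (hIiJ : IsFrame (Pc (nb (nb x t₂) (-(Jstep Pc nb ⟨x, t₁, t₂, U⟩).t₁)))
      (IinvStep Pc nb (Jstep Pc nb ⟨x, t₁, t₂, U⟩)).t₁ (IinvStep Pc nb (Jstep Pc nb ⟨x, t₁, t₂, U⟩)).t₂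
      (IinvStep Pc nb (Jstep Pc nb ⟨x, t₁, t₂, U⟩)).U)
    (hcomm : Istep Pc nb (Jstep Pc nb ⟨x, t₁, t₂, U⟩) = Jstep Pc nb (Istep Pc nb ⟨x, t₁, t₂, U⟩)) :
    Vstep Pc nb (Jstep Pc nb ⟨x, t₁, t₂, U⟩) = Jstep Pc nb (Vstep Pc nb ⟨x, t₁, t₂, U⟩) := by
  have hPx := pattern_cases hch hx
  have hU' : IsFrame (Pc x) t₂ t₁ U := isFrame_swap hU
  obtain ⟨hI', hJ', hIi', hJi'⟩ := swap_hyps (Pc := Pc) (nb := nb) hI hJ hIi hJi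
  -- the four second-order hypotheses for the swapped frame
  have hII' : IsFrame (Pc (nb (nb x t₂) (Istep Pc nb ⟨x, t₂, t₁, U⟩).t₁))
      (Istep Pc nb (Istep Pc nb ⟨x, t₂, t₁, U⟩)).t₁ (Istep Pc nb (Istep Pc nb ⟨x, t₂, t₁, U⟩)).t₂
      (Istep Pc nb (Istep Pc nb ⟨x, t₂, t₁, U⟩)).U := by
    rw [Istep_swap x t₁ t₂ U, Istep_swap' (Jstep Pc nb ⟨x, t₁, t₂, U⟩)]
    exact isFrame_swap hJJ
  have hJI' : IsFrame (Pc (nb (nb x t₂) (Istep Pc nb ⟨x, t₂, t₁, U⟩).t₂))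
      (Jstep Pc nb (Istep Pc nb ⟨x, t₂, t₁, U⟩)).t₁ (Jstep Pc nb (Istep Pc nb ⟨x, t₂, t₁, U⟩)).t₂
      (Jstep Pc nb (Istep Pc nb ⟨x, t₂, t₁, U⟩)).U := by
    rw [Istep_swap x t₁ t₂ U, Jstep_swap' (Jstep Pc nb ⟨x, t₁, t₂, U⟩)]
    exact isFrame_swap hIJ
  have hIiI' : IsFrame (Pc (nb (nb x t₂) (-(Istep Pc nb ⟨x, t₂, t₁, U⟩).t₁)))
      (IinvStep Pc nb (Istep Pc nb ⟨x, t₂, t₁, U⟩)).t₁ (IinvStep Pc nb (Istep Pc nb ⟨x, t₂, t₁, U⟩)).t₂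
      (IinvStep Pc nb (Istep Pc nb ⟨x, t₂, t₁, U⟩)).U := by
    rw [Istep_swap x t₁ t₂ U, IinvStep_swap' (Jstep Pc nb ⟨x, t₁, t₂, U⟩)]
    exact isFrame_swap hJiJ
  have hJiI' : IsFrame (Pc (nb (nb x t₂) (-(Istep Pc nb ⟨x, t₂, t₁, U⟩).t₂)))
      (JinvStep Pc nb (Istep Pc nb ⟨x, t₂, t₁, U⟩)).t₁ (JinvStep Pc nb (Istep Pc nb ⟨x, t₂, t₁, U⟩)).t₂
      (JinvStep Pc nb (Istep Pc nb ⟨x, t₂, t₁, U⟩)).U := by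
    rw [Istep_swap x t₁ t₂ U, JinvStep_swap' (Jstep Pc nb ⟨x, t₁, t₂, U⟩)]
    exact isFrame_swap hIiJ
  have hcomm' : Istep Pc nb (Jstep Pc nb ⟨x, t₂, t₁, U⟩) = Jstep Pc nb (Istep Pc nb ⟨x, t₂, t₁, U⟩) := by
    rw [Jstep_swap x t₂ t₁ U, Istep_swap x t₁ t₂ U, Istep_swap' (Istep Pc nb ⟨x, t₁, t₂, U⟩),
      Jstep_swap' (Jstep Pc nb ⟨x, t₁, t₂, U⟩), hcomm]
  -- the I-commutation for the swapped frame
  have key := Vstep_Istep_comm hch hx hU' hI' hJ' hIi' hJi' hII' hJI' hIiI' hJiI' hcomm'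
  -- translate back
  have hregJ := hregJ_of_valid (Pc := Pc) (nb := nb) hJ
  obtain ⟨hyJS, -, -, -, -, -, -, -, -, -, -, hJframe, -⟩ := Jstep_spec hch hx hU hregJ
  have hPyJ := pattern_cases hch hyJS
  rw [Istep_swap x t₁ t₂ U, Vstep_swap hPx hU] at key
  rw [Vstep_swap' (f := Jstep Pc nb ⟨x, t₁, t₂, U⟩) hPyJ hJframe] at key
  rw [Istep_swap' (Pc := Pc) (nb := nb) (Vstep Pc nb ⟨x, t₁, t₂, U⟩)] at key
  obtain ⟨h1, h2, h3, h4⟩ := ZFrame.mk.inj key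
  exact ZFrame.ext' h1 h3 h2 h4

end Summit.AtomisticToContinuum.Crystallization.Theorems.PalmUnimodularRigidityShellsToBarlowChart

end
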